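import Summits.CriticalPhenomena.Ising3DConformalLimit.Theorems.PrecisionLaplacianDirectCorrelationStableTailExponentWindow
import Summits.CriticalPhenomena.Ising3DConformalLimit.Theorems.PrecisionLaplacianDirectCorrelationStableTailTightness
import Summits.CriticalPhenomena.Ising3DConformalLimit.Theorems.PrecisionLaplacianDirectCorrelationStableTailScaleIdentity
import Summits.CriticalPhenomena.Ising3DConformalLimit.Theorems.PrecisionLaplacianDirectCorrelationStableTailKernelScaling
import Summits.CriticalPhenomena.Ising3DConformalLimit.Theorems.PrecisionLaplacianDirectCorrelationStableTailRieszGaussian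
import Summits.CriticalPhenomena.Ising3DConformalLimit.Theorems.PrecisionLaplacianDirectCorrelationStableTailSymbolIdentification
import Summits.CriticalPhenomena.Ising3DConformalLimit.Theorems.PrecisionLaplacianDirectCorrelationStableTailClosureModuloStableScaling
import HarnessLib

/-!
# A measure-level converse Tauberian theorem for lattice Green kernels (Ising-free dividend of line
# `diffusive-branch-is-nonsaturation`, crux `PrecisionLaplacian.DirectCorrelationStableTail`, stmt-CriticalPhenomena-4799)

Continuation lead prover-line-stmt-CriticalPhenomena-4799-c4-0 (2026-08-17).  Pure theorem file (no definitions, no `sorry`).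

**Statement** (`stableLevyScaling_of_twoPointLaw_of_levyContinuity`, registered bookkeeping stub
`stub_converseTauberianModuloLevyContinuity`).  Let `G : ℤ³ → [0,1]` be even and `m ∈ ℓ¹(ℤ³)` its precision row:
`Σ m = 0`, `m ≥ 0` off `0`, `Σ_y m(y)G(z − y) = −δ_{z0}`; assume the two STRUCTURAL inputs
(i) box capture `Σ_{z∈B_R} G(z+v) ≤ Σ_{z∈B_R} G(z)` (Messager–Miracle-Solé for the Ising model) and
(ii) coordinate sign-flip invariance of `m` with antitone slab sums `S_i(n+1) ≤ S_i(n)`, `n ≥ 1` (nine-mirror RP + Pick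
inversion for the Ising model), and the ISOTROPIC PURE POWER LAW `G(x)|x|₂^{3−α} → c > 0`, `1 < α < 2`.  Then, modulo the
Lévy-continuity stub S6 (`stub_levyContinuityTransfer`, carried verbatim as the hypothesis `hS6`), the jump law `m` has
STABLE LÉVY SCALING with an isotropic profile: `R^α Σ_x m(x) f(x/R) → ∫ f(y) Φ₀|y|₂^{−3−α} dy` for `f ∈ C_c(ℝ³∖0)`, `Φ₀ > 0`.

Without (i)–(ii) the statement is FALSE (Disproof.lean §7.3: Williamson-type oscillating step laws); (i) gives tightness of the
rescaled jump measures at infinity (flux identity), (ii) at zero.  Proof: the landed stubs `stub_tightness` (S1),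
`stub_symbolIdentification` (S5, fed with `stub_scaleIdentity` S2, `stub_kernelScaling` S3, `stub_rieszGaussian` S4), the
Ising-free scale bounds `expWin_scaleBounds_of_tendsto` (S0 file), and `hS6`.  This is the abstract core of the converse two-point
spine (`…ConverseSpineModulo.lean`); it is stated for reuse by any route that obtains two-point asymptotics first.
References: folklore for the pieces; the organisation around the precision identity is this line's.
-/

noncomputable section

namespace Summit.CriticalPhenomena.Ising3DConformalLimit.Cruxes.DirectCorrelationStableTail.DiffusiveBranchIsNonsaturation

open MeasureTheory Filter Topology
open scoped BigOperators
open Literature.Probability.LatticeModels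

/-- **Measure-level converse Tauberian theorem (modulo S6).**  See the module docstring. -/
theorem stableLevyScaling_of_twoPointLaw_of_levyContinuity
    (hS6 :
      ∀ (m : Site 3 → ℝ) (α c' C C' : ℝ) (R₁ : ℕ),
      Summable m → (∀ y, y ≠ 0 → 0 ≤ m y) → (∀ y, m (-y) = m y) → 0 < α → α < 2 → 0 < c' →
      (∀ R : ℕ, R₁ ≤ R → ∀ T : Finset (Site 3), (∀ y ∈ T, (R : ℝ) ≤ ‖y‖) → (R : ℝ) ^ α * ∑ y ∈ T, m y ≤ C) →
      (∀ R : ℕ, 1 ≤ R → ∑ y ∈ box 3 R, m y * (∑ i, ((y i : ℝ)) ^ 2) ≤ C' * (R : ℝ) ^ (2 - α)) →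
      (∀ k : Fin 3 → ℝ,
      Filter.Tendsto (fun R : ℕ => (R : ℝ) ^ α * ∑' y : Site 3, m y * (1 - Real.cos (∑ i, k i * ((y i : ℝ) / R))))
      Filter.atTop (nhds (c' * Real.sqrt (∑ i, k i ^ 2) ^ α))) →
      ∃ Φ₀ : ℝ, 0 < Φ₀ ∧ ∀ f : (Fin 3 → ℝ) → ℝ, Continuous f → HasCompactSupport f → (0 : Fin 3 → ℝ) ∉ tsupport f →
      Filter.Tendsto (fun R : ℕ => (R : ℝ) ^ α * ∑' x : Site 3, m x * f (fun j => (x j : ℝ) / (R : ℝ)))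
      Filter.atTop (nhds (∫ y : Fin 3 → ℝ, f y * (Φ₀ * Real.sqrt (∑ l, y l ^ 2) ^ (-(3 + α))))))
    (m G : Site 3 → ℝ) (α c : ℝ)
    (hsum : Summable m) (hzero : (∑' y, m y) = 0) (hnn : ∀ y, y ≠ 0 → 0 ≤ m y)
    (hflip : ∀ (j : Fin 3) (y : Site 3), m (Function.update y j (-y j)) = m y)
    (hanti : ∀ (i : Fin 3) (n : ℕ), 1 ≤ n → (∑' y : Fin 2 → ℤ, m (Fin.insertNth i ((n + 1 : ℕ) : ℤ) (y) : Site 3)) ≤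
      ∑' y : Fin 2 → ℤ, m (Fin.insertNth i (n : ℤ) (y) : Site 3))
    (hconv : ∀ z : Site 3, (∑' y, m y * G (z - y)) = if z = 0 then -1 else 0)
    (hcap : ∀ (R : ℕ) (v : Site 3), ∑ z ∈ box 3 R, G (z + v) ≤ ∑ z ∈ box 3 R, G z)
    (hG0 : ∀ x, 0 ≤ G x) (hG1 : ∀ x, G x ≤ 1) (hGe : ∀ x, G (-x) = G x)
    (hα1 : 1 < α) (hα2 : α < 2) (hc : 0 < c)
    (hT : Tendsto (fun x : Site 3 => G x * Real.sqrt (∑ i, ((x i : ℝ)) ^ 2) ^ (3 - α)) cofinite (𝓝 c)) :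
    ∃ Φ₀ : ℝ, 0 < Φ₀ ∧ ∀ f : (Fin 3 → ℝ) → ℝ, Continuous f → HasCompactSupport f → (0 : Fin 3 → ℝ) ∉ tsupport f →
      Tendsto (fun R : ℕ => (R : ℝ) ^ α * ∑' x : Site 3, m x * f (fun j => (x j : ℝ) / (R : ℝ))) atTop
        (𝓝 (∫ y : Fin 3 → ℝ, f y * (Φ₀ * Real.sqrt (∑ l, y l ^ 2) ^ (-(3 + α))))) := by
  have heven : ∀ x : Site 3, m (-x) = m x := fun x => SelfEnergyPickInversion.even_of_coordinate_flips hflip x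
  obtain ⟨c₁, C₁, R₀, hc₁, -, hup, hlo⟩ :=
    expWin_scaleBounds_of_tendsto (by linarith : (0 : ℝ) ≤ 3 - α) hc hG1 hT
  have hexp : (-(3 - α) : ℝ) = α - 3 := by ring
  have hup' : ∀ x : Site 3, x ≠ 0 → G x ≤ C₁ * ‖x‖ ^ (α - 3) := fun x hx => by rw [← hexp]; exact hup x hx
  have hlo' : ∀ x : Site 3, (R₀ : ℝ) ≤ ‖x‖ → c₁ * ‖x‖ ^ (α - 3) ≤ G x := fun x hx => by rw [← hexp]; exact hlo x hx
  obtain ⟨C, C', R₁, hinf, hzer⟩ := stub_tightness m G α c₁ C₁ R₀ hsum hzero hnn hflip hanti hconv hcap hG0 hα1 hα2 hc₁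
    hup' hlo'
  obtain ⟨c', hc', hψ⟩ := stub_symbolIdentification m G α c C C' R₁ hsum hzero hnn heven hG0 hG1 hGe hconv hα1 hα2 hc
    hinf hzer stub_scaleIdentity (fun t k ht => stub_kernelScaling G α c t k hG0 hG1 hGe hα1 hα2 hc ht hT)
    (stub_rieszGaussian α hα1 hα2)
  exact hS6 m α c' C C' R₁ hsum hnn heven (by linarith) hα2 hc' hinf hzer hψ

/-- **Registered bookkeeping stub `stub_converseTauberianModuloLevyContinuity`** (= the theorem above, explicit binders). -/
theorem stub_converseTauberianModuloLevyContinuity :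
    (∀ (m : Site 3 → ℝ) (α c' C C' : ℝ) (R₁ : ℕ),
      Summable m → (∀ y, y ≠ 0 → 0 ≤ m y) → (∀ y, m (-y) = m y) → 0 < α → α < 2 → 0 < c' →
      (∀ R : ℕ, R₁ ≤ R → ∀ T : Finset (Site 3), (∀ y ∈ T, (R : ℝ) ≤ ‖y‖) → (R : ℝ) ^ α * ∑ y ∈ T, m y ≤ C) →
      (∀ R : ℕ, 1 ≤ R → ∑ y ∈ box 3 R, m y * (∑ i, ((y i : ℝ)) ^ 2) ≤ C' * (R : ℝ) ^ (2 - α)) →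
      (∀ k : Fin 3 → ℝ,
      Filter.Tendsto (fun R : ℕ => (R : ℝ) ^ α * ∑' y : Site 3, m y * (1 - Real.cos (∑ i, k i * ((y i : ℝ) / R))))
      Filter.atTop (nhds (c' * Real.sqrt (∑ i, k i ^ 2) ^ α))) →
      ∃ Φ₀ : ℝ, 0 < Φ₀ ∧ ∀ f : (Fin 3 → ℝ) → ℝ, Continuous f → HasCompactSupport f → (0 : Fin 3 → ℝ) ∉ tsupport f →
      Filter.Tendsto (fun R : ℕ => (R : ℝ) ^ α * ∑' x : Site 3, m x * f (fun j => (x j : ℝ) / (R : ℝ)))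
      Filter.atTop (nhds (∫ y : Fin 3 → ℝ, f y * (Φ₀ * Real.sqrt (∑ l, y l ^ 2) ^ (-(3 + α)))))) →
    ∀ (m G : Site 3 → ℝ) (α c : ℝ), Summable m → (∑' y, m y) = 0 → (∀ y, y ≠ 0 → 0 ≤ m y) →
      (∀ (j : Fin 3) (y : Site 3), m (Function.update y j (-y j)) = m y) →
      (∀ (i : Fin 3) (n : ℕ), 1 ≤ n → (∑' y : Fin 2 → ℤ, m (Fin.insertNth i ((n + 1 : ℕ) : ℤ) (y) : Site 3)) ≤
        ∑' y : Fin 2 → ℤ, m (Fin.insertNth i (n : ℤ) (y) : Site 3)) →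
      (∀ z : Site 3, (∑' y, m y * G (z - y)) = if z = 0 then -1 else 0) →
      (∀ (R : ℕ) (v : Site 3), ∑ z ∈ box 3 R, G (z + v) ≤ ∑ z ∈ box 3 R, G z) →
      (∀ x, 0 ≤ G x) → (∀ x, G x ≤ 1) → (∀ x, G (-x) = G x) → 1 < α → α < 2 → 0 < c →
      Filter.Tendsto (fun x : Site 3 => G x * Real.sqrt (∑ i, ((x i : ℝ)) ^ 2) ^ (3 - α)) Filter.cofinite (nhds c) →
      ∃ Φ₀ : ℝ, 0 < Φ₀ ∧ ∀ f : (Fin 3 → ℝ) → ℝ, Continuous f → HasCompactSupport f → (0 : Fin 3 → ℝ) ∉ tsupport f →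
        Filter.Tendsto (fun R : ℕ => (R : ℝ) ^ α * ∑' x : Site 3, m x * f (fun j => (x j : ℝ) / (R : ℝ))) Filter.atTop
          (nhds (∫ y : Fin 3 → ℝ, f y * (Φ₀ * Real.sqrt (∑ l, y l ^ 2) ^ (-(3 + α))))) :=
  fun hS6 m G α c hsum hzero hnn hflip hanti hconv hcap hG0 hG1 hGe hα1 hα2 hc hT =>
    stableLevyScaling_of_twoPointLaw_of_levyContinuity hS6 m G α c hsum hzero hnn hflip hanti hconv hcap hG0 hG1 hGe
      hα1 hα2 hc hT

end Summit.CriticalPhenomena.Ising3DConformalLimit.Cruxes.DirectCorrelationStableTail.DiffusiveBranchIsNonsaturation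

end
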